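import Mathlib.Analysis.SpecialFunctions.Trigonometric.Deriv
import Mathlib.Analysis.SpecialFunctions.Exponential
import Mathlib.Analysis.SpecialFunctions.Log.Basic
import Mathlib.Analysis.Complex.ExponentialBounds

/-!
# `SignConeOscillatory` (crux stmt-RiemannHypothesis-16302) — negative lemma §A′, numerics layer

Companion of `Theorems/SignConeOscillatory/Negative/WithoutPDOriginDominating.lean`, which refutes the mutation
of the crux `Summit.RiemannHypothesis.RiemannHypothesis.Theses.SignCone.SignConeOscillatory` in which the cone
structure `F = Σᵢ gᵢ ⋆ g̃ᵢ` is replaced by "`F` smooth, compactly supported in `[-2a, 2a]`, hermitian AND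
origin-dominating (`‖F t‖ ≤ Re F(0)`)" (the disprover's documented §A′ of `Cruxes/SignConeOscillatory/Disproof.lean`).

For a REAL even witness `F` with `F(0) = 1` one has, in Bombieri's form of the archimedean term,
`Re W_ar(F) + F(0) = 1 - (log 4π + γ) + ∫₀^∞ D(t) dt`,
`D(t) = 2 F(t) (e^{-t/2} + e^{t/2}) - (e^{t/2} F(t) - 1)/sinh t = F(t)·B(v) + 2v²/(v⁴ - 1)`, `v = e^{t/2}`,
`B(v) = 2(v + v⁻¹) - 2v³/(v⁴ - 1)` (`dfun_eq`).  This file supplies the CELL BOUNDS for `D` on intervals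
`t ∈ [α, β]` according to the value of `F` there (`F = 1`, `0 ≤ F ≤ 1`, `-1 ≤ F ≤ 0`, `F = -1`; all monotone in
`v ∈ [e^{α/2}, e^{β/2}]`), the tail bound `2v²/(v⁴-1) ≤ 2e^{-t}/(1 - e^{-2T})`, and 25 decimal enclosures of
`exp` at the cell endpoints (Taylor partial sums / `Real.exp_bound'`).  No definitions.
-/

noncomputable section

-- `Summit.RiemannHypothesis.RiemannHypothesis.…` repeats a namespace component by design (D-0017 layout).
set_option linter.dupNamespace false

namespace Summit.RiemannHypothesis.RiemannHypothesis.Theorems.SignConeOscillatory.Negative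

/-! ## The combined polar + archimedean density in the variable `v = e^{t/2}` -/

/-- For `t > 0`, `v = e^{t/2}` and a real value `y`:
`2y(e^{-t/2} + e^{t/2}) - (e^{t/2} y - 1)/sinh t = y (2(v + v⁻¹) - 2v³/(v⁴ - 1)) + 2v²/(v⁴ - 1)`. -/
theorem dfun_eq (y t : ℝ) (ht : 0 < t) :
    2 * (y * (Real.exp (-(t / 2)) + Real.exp (t / 2))) - (Real.exp (t / 2) * y - 1) / Real.sinh t =
      y * (2 * (Real.exp (t / 2) + (Real.exp (t / 2))⁻¹) -
          2 * Real.exp (t / 2) ^ 3 / (Real.exp (t / 2) ^ 4 - 1)) +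
        2 * Real.exp (t / 2) ^ 2 / (Real.exp (t / 2) ^ 4 - 1) := by
  set v : ℝ := Real.exp (t / 2) with hv
  have hv1 : 1 < v := by rw [hv]; exact Real.one_lt_exp_iff.2 (by linarith)
  have hv0 : 0 < v := by linarith
  have hneg : Real.exp (-(t / 2)) = v⁻¹ := by rw [Real.exp_neg]
  have hexp_t : Real.exp t = v ^ 2 := by
    rw [hv, ← Real.exp_nat_mul]; congr 1; push_cast; ring
  have hexp_negt : Real.exp (-t) = (v ^ 2)⁻¹ := by rw [Real.exp_neg, hexp_t]
  have hsinh : Real.sinh t = (v ^ 2 - (v ^ 2)⁻¹) / 2 := by rw [Real.sinh_eq, hexp_t, hexp_negt]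
  have h4 : v ^ 4 - 1 ≠ 0 := by
    have := one_lt_pow₀ hv1 (by norm_num : (4 : ℕ) ≠ 0)
    linarith
  have h2 : v ^ 2 - (v ^ 2)⁻¹ ≠ 0 := by
    have : (v ^ 2)⁻¹ < 1 := inv_lt_one_of_one_lt₀ (by nlinarith)
    nlinarith
  rw [hneg, hsinh]
  field_simp
  ring

/-! ## Monotone pieces -/

/-- `a + a⁻¹ ≤ v + v⁻¹` for `1 ≤ a ≤ v`. -/
theorem add_inv_le_add_inv {a v : ℝ} (ha : 1 ≤ a) (hav : a ≤ v) : a + a⁻¹ ≤ v + v⁻¹ := by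
  have ha0 : 0 < a := by linarith
  have hv0 : 0 < v := by linarith
  have key : v + v⁻¹ - (a + a⁻¹) = (v - a) * (1 - (a * v)⁻¹) := by
    field_simp
    ring
  have h1 : (a * v)⁻¹ ≤ 1 := inv_le_one_of_one_le₀ (by nlinarith)
  nlinarith [mul_nonneg (sub_nonneg.2 hav) (sub_nonneg.2 h1)]

/-- `2v²/(v⁴ - 1) ≤ 2a²/(a⁴ - 1)` for `1 < a ≤ v` (`1/sinh` is decreasing). -/
theorem sq_div_le {a v : ℝ} (ha : 1 < a) (hav : a ≤ v) :
    2 * v ^ 2 / (v ^ 4 - 1) ≤ 2 * a ^ 2 / (a ^ 4 - 1) := by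
  have ha4 : 0 < a ^ 4 - 1 := by nlinarith [one_lt_pow₀ ha (by norm_num : (4 : ℕ) ≠ 0)]
  have hv1 : 1 < v := by linarith
  have hv4 : 0 < v ^ 4 - 1 := by nlinarith [one_lt_pow₀ hv1 (by norm_num : (4 : ℕ) ≠ 0)]
  rw [div_le_div_iff₀ hv4 ha4]
  have h2 : a ^ 2 ≤ v ^ 2 := pow_le_pow_left₀ (by linarith) hav 2
  nlinarith [mul_nonneg (mul_nonneg (sq_nonneg a) (sq_nonneg v)) (sub_nonneg.2 h2)]

/-- `2v³/(v⁴ - 1) ≤ 2a³/(a⁴ - 1)` for `1 < a ≤ v` (`e^{t/2}/sinh t` is decreasing). -/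
theorem cube_div_le {a v : ℝ} (ha : 1 < a) (hav : a ≤ v) :
    2 * v ^ 3 / (v ^ 4 - 1) ≤ 2 * a ^ 3 / (a ^ 4 - 1) := by
  have ha4 : 0 < a ^ 4 - 1 := by nlinarith [one_lt_pow₀ ha (by norm_num : (4 : ℕ) ≠ 0)]
  have hv1 : 1 < v := by linarith
  have hv4 : 0 < v ^ 4 - 1 := by nlinarith [one_lt_pow₀ hv1 (by norm_num : (4 : ℕ) ≠ 0)]
  rw [div_le_div_iff₀ hv4 ha4]
  have h3 : a ^ 3 ≤ v ^ 3 := pow_le_pow_left₀ (by linarith) hav 3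
  have ha3 : 0 ≤ a ^ 3 := by positivity
  have hv3 : 0 ≤ v ^ 3 := by positivity
  nlinarith [mul_nonneg (mul_nonneg ha3 hv3) (sub_nonneg.2 hav)]

/-- The bracket `B(v) = 2(v + v⁻¹) - 2v³/(v⁴ - 1)` is nonnegative as soon as `a⁶ - a² - 1 ≥ 0` for some
`1 < a ≤ v` (i.e. `t ≥ 0.283…`). -/
theorem bracket_nonneg {a v : ℝ} (ha : 1 < a) (hav : a ≤ v) (h6 : 0 ≤ a ^ 6 - a ^ 2 - 1) :
    0 ≤ 2 * (v + v⁻¹) - 2 * v ^ 3 / (v ^ 4 - 1) := by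
  have hv1 : 1 < v := by linarith
  have hv0 : 0 < v := by linarith
  have hv4 : 0 < v ^ 4 - 1 := by nlinarith [one_lt_pow₀ hv1 (by norm_num : (4 : ℕ) ≠ 0)]
  have h2 : a ^ 2 ≤ v ^ 2 := pow_le_pow_left₀ (by linarith) hav 2
  have hv6 : 0 ≤ v ^ 6 - v ^ 2 - 1 := by
    have key : v ^ 6 - v ^ 2 - 1 = (a ^ 6 - a ^ 2 - 1) + (v ^ 2 - a ^ 2) * (v ^ 4 + v ^ 2 * a ^ 2 + a ^ 4 - 1) := by
      ring
    have hX : 0 ≤ v ^ 4 + v ^ 2 * a ^ 2 + a ^ 4 - 1 := by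
      have := one_lt_pow₀ hv1 (by norm_num : (4 : ℕ) ≠ 0)
      nlinarith [sq_nonneg (v * a), sq_nonneg (a ^ 2)]
    rw [key]
    exact add_nonneg h6 (mul_nonneg (sub_nonneg.2 h2) hX)
  have e : v + v⁻¹ = (v ^ 2 + 1) / v := by field_simp
  have key : v ^ 3 / (v ^ 4 - 1) ≤ (v ^ 2 + 1) / v := by
    rw [div_le_div_iff₀ hv4 hv0]
    nlinarith [hv6]
  have e2 : 2 * v ^ 3 / (v ^ 4 - 1) = 2 * (v ^ 3 / (v ^ 4 - 1)) := by ring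
  rw [e, e2]
  linarith

/-! ## Cell bounds for `D = y·B(v) + 2v²/(v⁴ - 1)` -/

/-- Cell with `F = -1`: `D ≤ -2(a + a⁻¹) + 2a³/(a⁴-1) + 2a²/(a⁴-1)`, `a` a lower bound of `e^{α/2}`. -/
theorem cell_neg_one {a v : ℝ} (ha : 1 < a) (hav : a ≤ v) :
    (-1) * (2 * (v + v⁻¹) - 2 * v ^ 3 / (v ^ 4 - 1)) + 2 * v ^ 2 / (v ^ 4 - 1) ≤
      -2 * (a + a⁻¹) + 2 * a ^ 3 / (a ^ 4 - 1) + 2 * a ^ 2 / (a ^ 4 - 1) := by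
  have h1 := add_inv_le_add_inv ha.le hav
  have h2 := sq_div_le ha hav
  have h3 := cube_div_le ha hav
  linarith

/-- Cell with `-1 ≤ F ≤ 0` (and `B ≥ 0` there): `D ≤ 2a²/(a⁴-1)`. -/
theorem cell_neg_shoulder {a v y : ℝ} (ha : 1 < a) (hav : a ≤ v) (h6 : 0 ≤ a ^ 6 - a ^ 2 - 1)
    (hy : y ≤ 0) :
    y * (2 * (v + v⁻¹) - 2 * v ^ 3 / (v ^ 4 - 1)) + 2 * v ^ 2 / (v ^ 4 - 1) ≤ 2 * a ^ 2 / (a ^ 4 - 1) := by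
  have hB := bracket_nonneg ha hav h6
  have h2 := sq_div_le ha hav
  nlinarith [mul_nonneg (neg_nonneg.2 hy) hB]

/-- Cell with `F = 0`: `D ≤ 2a²/(a⁴-1)`. -/
theorem cell_zero {a v : ℝ} (ha : 1 < a) (hav : a ≤ v) :
    0 * (2 * (v + v⁻¹) - 2 * v ^ 3 / (v ^ 4 - 1)) + 2 * v ^ 2 / (v ^ 4 - 1) ≤ 2 * a ^ 2 / (a ^ 4 - 1) := by
  rw [zero_mul, zero_add]
  exact sq_div_le ha hav

/-- Cell with `0 ≤ F ≤ 1`: `D ≤ (2(b + b⁻¹) - 2b³/(b⁴-1)) + 2a²/(a⁴-1)` for `1 < a ≤ v ≤ b`, provided the first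
bracket is nonnegative. -/
theorem cell_pos_shoulder {a b v y : ℝ} (ha : 1 < a) (hav : a ≤ v) (hvb : v ≤ b)
    (hb : 0 ≤ 2 * (b + b⁻¹) - 2 * b ^ 3 / (b ^ 4 - 1)) (hy0 : 0 ≤ y) (hy1 : y ≤ 1) :
    y * (2 * (v + v⁻¹) - 2 * v ^ 3 / (v ^ 4 - 1)) + 2 * v ^ 2 / (v ^ 4 - 1) ≤
      (2 * (b + b⁻¹) - 2 * b ^ 3 / (b ^ 4 - 1)) + 2 * a ^ 2 / (a ^ 4 - 1) := by
  have hv1 : 1 < v := by linarith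
  have h1 : v + v⁻¹ ≤ b + b⁻¹ := add_inv_le_add_inv hv1.le hvb
  have h3 : 2 * b ^ 3 / (b ^ 4 - 1) ≤ 2 * v ^ 3 / (v ^ 4 - 1) := cube_div_le hv1 hvb
  have hB : 2 * (v + v⁻¹) - 2 * v ^ 3 / (v ^ 4 - 1) ≤ 2 * (b + b⁻¹) - 2 * b ^ 3 / (b ^ 4 - 1) := by
    linarith
  have h2 := sq_div_le ha hav
  nlinarith [mul_le_mul_of_nonneg_left hB hy0, mul_le_of_le_one_left hb hy1]

/-- Cell with `F = 1`: `D ≤ 2(b + b⁻¹)` for `1 < v ≤ b` (the correction `-2v²(v-1)/(v⁴-1)` is `≤ 0`). -/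
theorem cell_pos_one {b v : ℝ} (hv1 : 1 < v) (hvb : v ≤ b) :
    1 * (2 * (v + v⁻¹) - 2 * v ^ 3 / (v ^ 4 - 1)) + 2 * v ^ 2 / (v ^ 4 - 1) ≤ 2 * (b + b⁻¹) := by
  have h1 : v + v⁻¹ ≤ b + b⁻¹ := add_inv_le_add_inv hv1.le hvb
  have hv4 : 0 < v ^ 4 - 1 := by nlinarith [one_lt_pow₀ hv1 (by norm_num : (4 : ℕ) ≠ 0)]
  have h2 : 2 * v ^ 2 / (v ^ 4 - 1) ≤ 2 * v ^ 3 / (v ^ 4 - 1) := by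
    refine div_le_div_of_nonneg_right ?_ hv4.le
    nlinarith [sq_nonneg v]
  linarith

/-- The value at `t = 0` (`v = 1`, junk `x/0 = 0`): `D = 4 ≤ 2(b + b⁻¹)` for `b ≥ 1`… in fact for `b > 0`. -/
theorem cell_pos_one_at_zero {b : ℝ} (hb : 1 ≤ b) :
    1 * (2 * ((1 : ℝ) + 1⁻¹) - 2 * 1 ^ 3 / (1 ^ 4 - 1)) + 2 * 1 ^ 2 / (1 ^ 4 - 1) ≤ 2 * (b + b⁻¹) := by
  have hb0 : 0 < b := by linarith
  have h : 2 ≤ b + b⁻¹ := by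
    have := add_inv_le_add_inv le_rfl hb
    norm_num at this
    linarith
  norm_num
  linarith

/-- Tail: for `0 < T ≤ t`, `2v²/(v⁴ - 1) ≤ (2/(1 - e^{-2T})) e^{-t}` with `v = e^{t/2}`. -/
theorem tail_pointwise {T t : ℝ} (hT : 0 < T) (hTt : T ≤ t) :
    2 * Real.exp (t / 2) ^ 2 / (Real.exp (t / 2) ^ 4 - 1) ≤
      2 / (1 - Real.exp (-(2 * T))) * Real.exp (-t) := by
  have ht : 0 < t := by linarith
  set w : ℝ := Real.exp t with hw
  have hw1 : 1 < w := Real.one_lt_exp_iff.2 ht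
  have hw0 : 0 < w := Real.exp_pos t
  have e2 : Real.exp (t / 2) ^ 2 = w := by rw [hw, ← Real.exp_nat_mul]; ring_nf
  have e4 : Real.exp (t / 2) ^ 4 = w ^ 2 := by
    rw [show (4 : ℕ) = 2 * 2 from rfl, pow_mul, e2]
  have eneg : Real.exp (-t) = w⁻¹ := by rw [Real.exp_neg]
  set E : ℝ := Real.exp (-(2 * T)) with hE
  have hE1 : E < 1 := Real.exp_lt_one_iff.2 (by linarith)
  have hE0 : 0 < E := Real.exp_pos _
  have hEw : 1 ≤ w ^ 2 * E := by
    rw [hw, hE, ← Real.exp_nat_mul, ← Real.exp_add]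
    exact Real.one_le_exp (by push_cast; linarith)
  rw [e2, e4, eneg]
  have hw2 : 0 < w ^ 2 - 1 := by nlinarith
  have hE2 : 0 < 1 - E := by linarith
  have ewinv : w⁻¹ * (w ^ 2 - 1) = w - w⁻¹ := by field_simp
  have hwinv : w⁻¹ ≤ w * E := by
    rw [inv_le_iff_one_le_mul₀ hw0]
    nlinarith
  have key : 2 * w / (w ^ 2 - 1) ≤ 2 * w⁻¹ / (1 - E) := by
    rw [div_le_div_iff₀ hw2 hE2]
    nlinarith [ewinv, hwinv, hw0]
  have e3 : 2 / (1 - E) * w⁻¹ = 2 * w⁻¹ / (1 - E) := by ring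
  rw [e3]
  exact key

/-! ## Decimal enclosures of `exp` at the cell endpoints (Taylor partial sums, 16 terms) -/

/-- `1.150273796 ≤ exp 0.14` (Taylor partial sum). -/
theorem exp_0_14_ge : (1.150273796 : ℝ) ≤ Real.exp 0.14 := by
  have hx0 : (0 : ℝ) ≤ 0.14 := by norm_num
  have hl := Real.sum_le_exp_of_nonneg hx0 16
  simp only [Finset.sum_range_succ, Finset.sum_range_zero] at hl
  exact le_trans (by norm_num [Nat.factorial]) hl

/-- `1.173510868 ≤ exp 0.16` (Taylor partial sum). -/
theorem exp_0_16_ge : (1.173510868 : ℝ) ≤ Real.exp 0.16 := by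
  have hx0 : (0 : ℝ) ≤ 0.16 := by norm_num
  have hl := Real.sum_le_exp_of_nonneg hx0 16
  simp only [Finset.sum_range_succ, Finset.sum_range_zero] at hl
  exact le_trans (by norm_num [Nat.factorial]) hl

/-- `1.197217361 ≤ exp 0.18` (Taylor partial sum). -/
theorem exp_0_18_ge : (1.197217361 : ℝ) ≤ Real.exp 0.18 := by
  have hx0 : (0 : ℝ) ≤ 0.18 := by norm_num
  have hl := Real.sum_le_exp_of_nonneg hx0 16
  simp only [Finset.sum_range_succ, Finset.sum_range_zero] at hl
  exact le_trans (by norm_num [Nat.factorial]) hl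

/-- `1.284025414 ≤ exp 0.25` (Taylor partial sum). -/
theorem exp_0_25_ge : (1.284025414 : ℝ) ≤ Real.exp 0.25 := by
  have hx0 : (0 : ℝ) ≤ 0.25 := by norm_num
  have hl := Real.sum_le_exp_of_nonneg hx0 16
  simp only [Finset.sum_range_succ, Finset.sum_range_zero] at hl
  exact le_trans (by norm_num [Nat.factorial]) hl

/-- `1.377127762 ≤ exp 0.32` (Taylor partial sum). -/
theorem exp_0_32_ge : (1.377127762 : ℝ) ≤ Real.exp 0.32 := by
  have hx0 : (0 : ℝ) ≤ 0.32 := by norm_num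
  have hl := Real.sum_le_exp_of_nonneg hx0 16
  simp only [Finset.sum_range_succ, Finset.sum_range_zero] at hl
  exact le_trans (by norm_num [Nat.factorial]) hl

/-- `1.404947588 ≤ exp 0.34` (Taylor partial sum). -/
theorem exp_0_34_ge : (1.404947588 : ℝ) ≤ Real.exp 0.34 := by
  have hx0 : (0 : ℝ) ≤ 0.34 := by norm_num
  have hl := Real.sum_le_exp_of_nonneg hx0 16
  simp only [Finset.sum_range_succ, Finset.sum_range_zero] at hl
  exact le_trans (by norm_num [Nat.factorial]) hl

/-- `1.419067546 ≤ exp 0.35` (Taylor partial sum). -/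
theorem exp_0_35_ge : (1.419067546 : ℝ) ≤ Real.exp 0.35 := by
  have hx0 : (0 : ℝ) ≤ 0.35 := by norm_num
  have hl := Real.sum_le_exp_of_nonneg hx0 16
  simp only [Finset.sum_range_succ, Finset.sum_range_zero] at hl
  exact le_trans (by norm_num [Nat.factorial]) hl

/-- `1.447734612 ≤ exp 0.37` (Taylor partial sum). -/
theorem exp_0_37_ge : (1.447734612 : ℝ) ≤ Real.exp 0.37 := by
  have hx0 : (0 : ℝ) ≤ 0.37 := by norm_num
  have hl := Real.sum_le_exp_of_nonneg hx0 16
  simp only [Finset.sum_range_succ, Finset.sum_range_zero] at hl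
  exact le_trans (by norm_num [Nat.factorial]) hl

/-- `1.537257521 ≤ exp 0.43` (Taylor partial sum). -/
theorem exp_0_43_ge : (1.537257521 : ℝ) ≤ Real.exp 0.43 := by
  have hx0 : (0 : ℝ) ≤ 0.43 := by norm_num
  have hl := Real.sum_le_exp_of_nonneg hx0 16
  simp only [Finset.sum_range_succ, Finset.sum_range_zero] at hl
  exact le_trans (by norm_num [Nat.factorial]) hl

/-- `1.632316217 ≤ exp 0.49` (Taylor partial sum). -/
theorem exp_0_49_ge : (1.632316217 : ℝ) ≤ Real.exp 0.49 := by
  have hx0 : (0 : ℝ) ≤ 0.49 := by norm_num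
  have hl := Real.sum_le_exp_of_nonneg hx0 16
  simp only [Finset.sum_range_succ, Finset.sum_range_zero] at hl
  exact le_trans (by norm_num [Nat.factorial]) hl

/-- `1.665291192 ≤ exp 0.51` (Taylor partial sum). -/
theorem exp_0_51_ge : (1.665291192 : ℝ) ≤ Real.exp 0.51 := by
  have hx0 : (0 : ℝ) ≤ 0.51 := by norm_num
  have hl := Real.sum_le_exp_of_nonneg hx0 16
  simp only [Finset.sum_range_succ, Finset.sum_range_zero] at hl
  exact le_trans (by norm_num [Nat.factorial]) hl

/-- `1.822118798 ≤ exp 0.6` (Taylor partial sum). -/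
theorem exp_0_6_ge : (1.822118798 : ℝ) ≤ Real.exp 0.6 := by
  have hx0 : (0 : ℝ) ≤ 0.6 := by norm_num
  have hl := Real.sum_le_exp_of_nonneg hx0 16
  simp only [Finset.sum_range_succ, Finset.sum_range_zero] at hl
  exact le_trans (by norm_num [Nat.factorial]) hl

/-- `2.013752705 ≤ exp 0.7` (Taylor partial sum). -/
theorem exp_0_7_ge : (2.013752705 : ℝ) ≤ Real.exp 0.7 := by
  have hx0 : (0 : ℝ) ≤ 0.7 := by norm_num
  have hl := Real.sum_le_exp_of_nonneg hx0 16
  simp only [Finset.sum_range_succ, Finset.sum_range_zero] at hl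
  exact le_trans (by norm_num [Nat.factorial]) hl

/-- `2.033991256 ≤ exp 0.71` (Taylor partial sum). -/
theorem exp_0_71_ge : (2.033991256 : ℝ) ≤ Real.exp 0.71 := by
  have hx0 : (0 : ℝ) ≤ 0.71 := by norm_num
  have hl := Real.sum_le_exp_of_nonneg hx0 16
  simp only [Finset.sum_range_succ, Finset.sum_range_zero] at hl
  exact le_trans (by norm_num [Nat.factorial]) hl

/-- `2.095935512 ≤ exp 0.74` (Taylor partial sum). -/
theorem exp_0_74_ge : (2.095935512 : ℝ) ≤ Real.exp 0.74 := by
  have hx0 : (0 : ℝ) ≤ 0.74 := by norm_num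
  have hl := Real.sum_le_exp_of_nonneg hx0 16
  simp only [Finset.sum_range_succ, Finset.sum_range_zero] at hl
  exact le_trans (by norm_num [Nat.factorial]) hl

/-- `2.159766251 ≤ exp 0.77` (Taylor partial sum). -/
theorem exp_0_77_ge : (2.159766251 : ℝ) ≤ Real.exp 0.77 := by
  have hx0 : (0 : ℝ) ≤ 0.77 := by norm_num
  have hl := Real.sum_le_exp_of_nonneg hx0 16
  simp only [Finset.sum_range_succ, Finset.sum_range_zero] at hl
  exact le_trans (by norm_num [Nat.factorial]) hl

/-- `2.181472263 ≤ exp 0.78` (Taylor partial sum). -/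
theorem exp_0_78_ge : (2.181472263 : ℝ) ≤ Real.exp 0.78 := by
  have hx0 : (0 : ℝ) ≤ 0.78 := by norm_num
  have hl := Real.sum_le_exp_of_nonneg hx0 16
  simp only [Finset.sum_range_succ, Finset.sum_range_zero] at hl
  exact le_trans (by norm_num [Nat.factorial]) hl

/-- `2.484322531 ≤ exp 0.91` (Taylor partial sum). -/
theorem exp_0_91_ge : (2.484322531 : ℝ) ≤ Real.exp 0.91 := by
  have hx0 : (0 : ℝ) ≤ 0.91 := by norm_num
  have hl := Real.sum_le_exp_of_nonneg hx0 16
  simp only [Finset.sum_range_succ, Finset.sum_range_zero] at hl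
  exact le_trans (by norm_num [Nat.factorial]) hl

/-- `2.857651116 ≤ exp 1.05` (Taylor partial sum). -/
theorem exp_1_05_ge : (2.857651116 : ℝ) ≤ Real.exp 1.05 := by
  have hx0 : (0 : ℝ) ≤ 1.05 := by norm_num
  have hl := Real.sum_le_exp_of_nonneg hx0 16
  simp only [Finset.sum_range_succ, Finset.sum_range_zero] at hl
  exact le_trans (by norm_num [Nat.factorial]) hl

/-- `2.886370987 ≤ exp 1.06` (Taylor partial sum). -/
theorem exp_1_06_ge : (2.886370987 : ℝ) ≤ Real.exp 1.06 := by
  have hx0 : (0 : ℝ) ≤ 1.06 := by norm_num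
  have hl := Real.sum_le_exp_of_nonneg hx0 16
  simp only [Finset.sum_range_succ, Finset.sum_range_zero] at hl
  exact le_trans (by norm_num [Nat.factorial]) hl

/-- `2.915379497 ≤ exp 1.07` (Taylor partial sum). -/
theorem exp_1_07_ge : (2.915379497 : ℝ) ≤ Real.exp 1.07 := by
  have hx0 : (0 : ℝ) ≤ 1.07 := by norm_num
  have hl := Real.sum_le_exp_of_nonneg hx0 16
  simp only [Finset.sum_range_succ, Finset.sum_range_zero] at hl
  exact le_trans (by norm_num [Nat.factorial]) hl

/-- `2.944679549 ≤ exp 1.08` (Taylor partial sum). -/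
theorem exp_1_08_ge : (2.944679549 : ℝ) ≤ Real.exp 1.08 := by
  have hx0 : (0 : ℝ) ≤ 1.08 := by norm_num
  have hl := Real.sum_le_exp_of_nonneg hx0 16
  simp only [Finset.sum_range_succ, Finset.sum_range_zero] at hl
  exact le_trans (by norm_num [Nat.factorial]) hl

/-- `2.974274070 ≤ exp 1.09` (Taylor partial sum). -/
theorem exp_1_09_ge : (2.974274070 : ℝ) ≤ Real.exp 1.09 := by
  have hx0 : (0 : ℝ) ≤ 1.09 := by norm_num
  have hl := Real.sum_le_exp_of_nonneg hx0 16
  simp only [Finset.sum_range_succ, Finset.sum_range_zero] at hl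
  exact le_trans (by norm_num [Nat.factorial]) hl

/-- `exp 0.14 ≤ 1.150273801` (Taylor remainder bound `Real.exp_bound'`). -/
theorem exp_0_14_le : Real.exp 0.14 ≤ (1.150273801 : ℝ) := by
  have hx0 : (0 : ℝ) ≤ 0.14 := by norm_num
  have hx1 : (0.14 : ℝ) ≤ 1 := by norm_num
  have hu := Real.exp_bound' hx0 hx1 (n := 16) (by norm_num)
  simp only [Finset.sum_range_succ, Finset.sum_range_zero] at hu
  exact le_trans hu (by norm_num [Nat.factorial])

/-- `exp 0.16 ≤ 1.173510873` (Taylor remainder bound `Real.exp_bound'`). -/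
theorem exp_0_16_le : Real.exp 0.16 ≤ (1.173510873 : ℝ) := by
  have hx0 : (0 : ℝ) ≤ 0.16 := by norm_num
  have hx1 : (0.16 : ℝ) ≤ 1 := by norm_num
  have hu := Real.exp_bound' hx0 hx1 (n := 16) (by norm_num)
  simp only [Finset.sum_range_succ, Finset.sum_range_zero] at hu
  exact le_trans hu (by norm_num [Nat.factorial])

/-- Anchor of this file on the crux item (registered sub-goal): the `v = e^{t/2}` form of the combined density
(`dfun_eq`, `∀`-form). -/
theorem originDominating_dfun : ∀ (y t : ℝ), 0 < t → 2 * (y * (Real.exp (-(t / 2)) + Real.exp (t / 2))) - (Real.exp (t / 2) * y - 1) / Real.sinh t = y * (2 * (Real.exp (t / 2) + (Real.exp (t / 2))⁻¹) - 2 * Real.exp (t / 2) ^ 3 / (Real.exp (t / 2) ^ 4 - 1)) + 2 * Real.exp (t / 2) ^ 2 / (Real.exp (t / 2) ^ 4 - 1) :=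
  fun y t ht => dfun_eq y t ht

end Summit.RiemannHypothesis.RiemannHypothesis.Theorems.SignConeOscillatory.Negative

end
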